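/-
Copyright (c) 2026 the pub-hodgecm-mathlib formalisation cell (harness21).  Prover seat hodgecm-mathlib-K2E1-p13 (g6), Track B ∕ K2-LIT, h413 = `stmt-HodgeConjecture-24833`,
R90-TF section S8 «ContSpec-n½», S8 dealer R90-CS-plan (g3) S8-R238 (1) ∕ RULING J-S8-V♭ (S8-R239 (4), this seat's census 2026-09-05T02:57:04Z READ «= (α)»): (V♭) :406 OF RECORD,
HYPOTHESIS-FIRST — the ONE opaque analytic letter (NP) of ★ `R90S8ResGMidBlockEqBotOfLettersU3` re-keyed, on the τ-admissible block `resGMidBlockτ`, to TWO NAMED estate letters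
(`hfacτ` the ∀-generator coordinate factorisation, `hVEC` the vector half of MW IV.1.11 at the middle pole) with the SCALAR half PAID from ★ F4∕F5.
-/
import Summits.HodgeConjecture.HodgeConjecture.Theorems.R90S8ResGMidBlockEqBotOfLettersU3       -- ★ (K2E1-p12): (V♭) OF LETTERS `resGMidBlock_eq_bot_of_noMiddlePole`, §1 `eq_zero_of_analyticAt_of_eventuallyEq_sub_mul`; brings ★ D1–D3, `LHalfNeZero`
import Summits.HodgeConjecture.HodgeConjecture.Theorems.R90S8ResGMidAtomTauU3Defs             -- ★ τ-DEFS (K2E1-p11): `IsTauLevel`, `tauLevel`, `IsArchFinite`, `resGMidAtomGenτ ∕ resGMidAtomτ ∕ resGMidBlockτ`, `resGMidBlockτ_le`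
import Summits.HodgeConjecture.HodgeConjecture.Theorems.K2E1ChiScatteringMiddlePoleU3          -- ★ F5 (K2E2-p12): brings ★ `tendsto_sub_three_halves_mul_qc` and ★ F4 `exists_differentiableOn_mul_chiScalar_cm_three`
import Summits.HodgeConjecture.HodgeConjecture.Theorems.K2E1ChiConstantTermHolomorphicCMThree    -- ★ (K2E1-p15): brings `borelConstantTerm`, `borelHeight` (the ℓ-CT currency of ★ `ctLedger_of_amplitudeRows`)
import Literature.NumberTheory.GaloisRepresentations.HeckeCharacterNormCharacter                -- ★ `HeckeCharacter.isUnitary_one`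
import HarnessLib

/-!
# S8 — `R90S8ResGMidBlockEqBotOfRecordU3`: (V♭) OF RECORD — `¬ LHalfNeZero (ξ.bcη⁻¹·μω) → resGMidBlockτ ξ μω = ⊥` (and `resGMidBlock = ⊥` under `hW1`) modulo the NAMED letters
# `hfacτ` (coordinate factorisation of every τ-admissible generator) and `hVEC` (MW IV.1.11, vector half), the scalar half paid

Track B ∕ R90-TF, crux h413 = `stmt-HodgeConjecture-24833`, route of record `HCCMUnconditional`; cell `hodgecm-mathlib`, section S8 «ContSpec-n½», socket B MID ∕ (V♭) :406 of
`Lines/R90_S8_ResidualSpectrumU3B.lean`.  THEOREMS ONLY (no `def`, no `instance`, no `notation`, no named-fact hypothesis, no `sorry`; default heartbeats); lane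
`--supports stmt-HodgeConjecture-24833 --as helper` (count-neutral).  CLOSES NO SOCKET: (V♭) is NOT at parity with (V) tonight (RULING J-S8-V♭: the quantifier gap is accepted) — the (V)
road needs ONE non-zero residue of ONE witness, the (V♭) road needs EVERY residue of EVERY generator at EVERY level to vanish.  This file makes that precise and pays what is payable.

THE MATHEMATICS ([MoeglinWaldspurger1995] IV.1.11, V.3.13; [Rogawski1990] §13.9 p. 229 (ii); [Langlands1976] §7).  A τ-admissible generator of the middle block (★ T3 `resGMidAtomGenτ`: a
K_∞-finite continuous pair section `φ` at a τ-level, an admissible continuation `(Ec, Sp)` of `z ↦ E(φ_z)` and its pole letter `Fp` at `3∕2`) vanishes iff `(z − 3∕2)·Ec z g → 0` for every `g`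
(★ (V♭) OF LETTERS, §1 here in the τ-key).  When `L(½, φ_ξ) = 0` (`¬ LHalfNeZero (ξ.bcη⁻¹·μω)`) and `φ_ξ ≠ 1`, the normalised intertwining scalar of the block,
`c(z) = L^S(z−1, φ_ξ)ζ^T(2z−2) ∕ (L^S(z, φ_ξ)ζ^T(2z−1))`, satisfies `(z−2)(2z−3)·c = G` with `G` holomorphic on `{1 < Re}` and **`G(3∕2) = 0`** (★ F4 `exists_differentiableOn_mul_chiScalar_cm_three`:
the `ζ^T(2z−2)` pole at `3∕2` is cancelled by `L(½, φ_ξ) = 0`; §2) — the SCALAR half, paid.  IF the constant-term coordinates `Qc_j` of the generator's continuation factor on the tube as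
`Q_j = a_j·c` with `a_j` holomorphic on `{1<Re}` (letter `hfacτ` — the ∀-generator twin of K2E2-p12's ★ coordinate factorisation of the (V) witness; (W)-core generalised), then EVERY
coordinate has zero residue at `3∕2` (★ F5 `tendsto_sub_three_halves_mul_qc` per coordinate, §3), hence so has the second constant-term coefficient `ψ(z, g) = ((Ec z)_B g − φ(g)H(g)^z)∕H(g)^{2−z}
= Σ_j Qc_j(z)·b_j(g)` at every `g` (§3).  IF, finally, a continued Eisenstein family whose constant term has zero residue at `3∕2` has zero residue there (letter `hVEC` — the VECTOR half of
MW IV.1.11 «the poles of `E` are the poles of its constant term»; roads: (A) residue class cuspidal + ★ `resGMidAtomGen_inner_cuspidal_eq_zero_of_letters` (K2E4-p14's OF RECORD), (B) Maass–Selberg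
boundedness + the T-hr2 limit letters), then `(z − 3∕2)·Ec z g → 0` for every τ-admissible generator and every `g`, i.e. (NP)τ, so `resGMidBlockτ ξ μω = ⊥` (§1), and `resGMidBlock ξ μω = ⊥`
under the (R)′ letter `hW1 : resGMidBlock ≤ resGMidBlockτ` (§5).
* §1 (NP)τ ⟹ `⊥`: `resGMidAtomGenτ_subset_zero_of_noMiddlePole`, `resGMidAtomτ_eq_bot_of_noMiddlePole`, **`resGMidBlockτ_eq_bot_of_noMiddlePole`**, `resGMidBlock_eq_bot_of_noMiddlePoleτ` (via `hW1`).
* §2 SCALAR (★ F4): **`chiScalarG_three_halves_eq_zero_of_not_lHalfNeZero`** (`φ ≠ 1`, `¬ LHalfNeZero φ ⟹ G(3∕2) = 0`, both parities of `η`).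
* §3 COORDINATES (★ F5): **`tendsto_sub_three_halves_mul_coord_of_factorisation`** (`Q = a·c` on the tube, `Qc = Q` there, `Qc` analytic off a co-discrete `P`, `G(3∕2) = 0 ⟹ (z−3∕2)·Qc z → 0`),
  `tendsto_sub_three_halves_mul_sum` (finite sums), `tendsto_sub_three_halves_mul_of_eventuallyEq_sum` (the CT coefficient through its eventual coordinate expansion).
* §5 HEADS: **`resGMidBlockτ_eq_bot_of_not_lHalfNeZero_of_record (hφ1) (hfacτ) (hVEC)`** and **`resGMidBlock_eq_bot_of_not_lHalfNeZero_of_record (hW1) (hφ1) (hfacτ) (hVEC)`** = the (V♭) :406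
  bytes `¬ LHalfNeZero (ξ.bcη⁻¹ * μω) → resGMidBlock L μ ξ μω = ⊥`.
VISIBLE LETTERS (named for the dealer's table): `hφu hφA hS hurφ hT hurη` (★ F4's frame for `φ := ξ.bcη⁻¹·μω`, `η := 1`), `hφ1 : ξ.bcη⁻¹·μω ≠ 1` (S: its restriction to `𝔸_{L⁺}` is `ω_{L∕L⁺} ≠ 1`),
**`hfacτ`** (L: (W)-core ∀ τ-admissible generators — K2E2-p12's `…EulerFactorisationKFinite…`, S8-R239 (3)), **`hVEC`** (L: MW IV.1.11 vector half — K2E4-p14's orthogonality OF RECORD + ★ CT-RES,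
or the MS road), and for the `resGMidBlock` head **`hW1`** ((R)′'s letter; `le_rfl` under B ED. 8).
HONEST LABEL: HC_CM is proved only modulo the 7 printed citations (2 remaining named inputs: hLiu418 = `stmt-HodgeConjecture-24832`, h413 = `stmt-HodgeConjecture-24833`) until rung 0
closes; REL ≠ ★ ≠ BUILT; this file asserts no named fact, is conditional by construction on the displayed letters, and closes no socket; count-neutral.

## References
* [MoeglinWaldspurger1995] C. Mœglin, J.-L. Waldspurger, *Spectral Decomposition and Eisenstein Series* (1995), IV.1.11, V.3.13.
* [Rogawski1990] J. D. Rogawski, *Automorphic Representations of Unitary Groups in Three Variables* (1990), §13.9 p. 229 (ii).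
* [Langlands1976] R. P. Langlands, *On the Functional Equations Satisfied by Eisenstein Series*, LNM 544 (1976), §7.
-/

set_option autoImplicit false
set_option linter.dupNamespace false  -- the mandated namespace `…HodgeConjecture.HodgeConjecture.R90.S8` (LEAD #1 L1) repeats the summit's segment

noncomputable section

open MeasureTheory Measure Set Filter Topology NumberField IsDedekindDomain
open scoped ENNReal NNReal Topology
open Literature.NumberTheory.Automorphic Literature.NumberTheory.Automorphic.UnitaryGroup Literature.NumberTheory.GaloisRepresentations Literature.NumberTheory.LFunctions AdelicGroupData ContRepresentation
open Literature.NumberTheory.Automorphic.Arthur2013.Leaves.TECR Literature.NumberTheory.Rogawski1990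
open Summit.HodgeConjecture.HodgeConjecture.Cruxes.H413.K2E1BorelEisensteinU
open Summit.HodgeConjecture.HodgeConjecture.Cruxes.H413.K2E1ChiSectionSpaceU3PairDefs
open Summit.HodgeConjecture.HodgeConjecture.Cruxes.H413.K2E1HeckeLHalfNeZeroDefs (LHalfNeZero)
open Summit.HodgeConjecture.HodgeConjecture.Cruxes.H413.K2E1ChiScatteringPoleDichotomyU3 (tendsto_sub_three_halves_mul_qc)
open Summit.HodgeConjecture.HodgeConjecture.Cruxes.H413.K2E1ChiIntertwiningScalarEulerQuotientU3CM (exists_differentiableOn_mul_chiScalar_cm_three)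

namespace Summit.HodgeConjecture.HodgeConjecture.R90.S8

/-! ## §1 (NP)τ ⟹ the τ-admissible block is `⊥` — the τ-key twin of ★ (V♭) OF LETTERS §2–§3 -/

section NoPole

variable (L : Type) [Field L] [NumberField L] [IsCMField L]
  (μ : Measure (quasiSplit (↥(maximalRealSubfield L)) L (IsCMField.complexConj L) 3).automorphicQuotient) (ξ : OneDimAutRepH L) (μω : HeckeCharacter L)
  (U₀ : Subgroup ↥(finAdelic (↥(maximalRealSubfield L)) L (IsCMField.complexConj L) 3 ((StdForm.antidiagonal 3).over L)))

/-- **THE τ-ADMISSIBLE GENERATORS VANISH under (NP)τ at the τ-level `U₀`**: for every K_∞-finite continuous pair section `φ` at `(tauLevel U₀, 1)`, every admissible continuation `(Ec, Sp)` (★ T3's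
clauses verbatim) and every `g`, `(z − 3∕2)·Ec z g → 0` on `𝓝[≠] (3∕2)` ⟹ `resGMidAtomGenτ ξ μω U₀ ⊆ {0}` (★ `eq_zero_of_analyticAt_of_eventuallyEq_sub_mul` at each `g`).
[cite: Rogawski1990, §13.9 p. 229 (ii)] [cite: MoeglinWaldspurger1995, IV.1.11, V.3.13] -/
theorem resGMidAtomGenτ_subset_zero_of_noMiddlePole
    (hNP : ∀ φ ∈ chiSectionSpacePair (ξ.bcη⁻¹ * ξ.bcψ⁻¹ * μω) ξ.ψ (tauLevel L U₀) ((1 : ↥(tauLevel L U₀) →* ℂ) : ↥(tauLevel L U₀) → ℂ), Continuous φ → IsArchFinite L φ →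
      ∀ (Ec : ℂ → (quasiSplit (↥(maximalRealSubfield L)) L (IsCMField.complexConj L) 3).Adelic → ℂ) (Sp : Finset ℂ), (∀ s ∈ Sp, s.im = 0 ∧ 1 < s.re ∧ s.re ≤ 2) →
        (∀ g, DifferentiableOn ℂ (fun z => Ec z g) ({z : ℂ | 1 < z.re} \ (↑Sp : Set ℂ))) → (∀ z : ℂ, 2 < z.re → Ec z = eisensteinSeriesU (flatSectionU φ z)) →
          ∀ g, Tendsto (fun z => (z - (3 : ℂ) / 2) * Ec z g) (𝓝[≠] ((3 : ℂ) / 2)) (𝓝 0)) :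
    resGMidAtomGenτ L μ ξ μω U₀ ⊆ {0} := by
  rintro f ⟨φ, hφ, hφc, hφa, Ec, Sp, hSp, hhol, hEis, Fp, hFp, hFpE, hf⟩
  have h0 : ∀ g, Fp g ((3 : ℂ) / 2) = 0 := fun g =>
    eq_zero_of_analyticAt_of_eventuallyEq_sub_mul (hFp g) (hFpE g) (hNP φ hφ hφc hφa Ec Sp hSp hhol hEis g)
  refine Set.mem_singleton_iff.2 (Lp.ext (hf.trans ?_))
  have hz : (fun x : (quasiSplit (↥(maximalRealSubfield L)) L (IsCMField.complexConj L) 3).automorphicQuotient => Fp (Quotient.out (x : (quasiSplit (↥(maximalRealSubfield L)) L (IsCMField.complexConj L) 3).Adelic ⧸ (quasiSplit (↥(maximalRealSubfield L)) L (IsCMField.complexConj L) 3).quotientSubgroup))⁻¹ ((3 : ℂ) / 2)) = fun _ => (0 : ℂ) :=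
    funext fun x => h0 _
  rw [hz]
  exact (Lp.coeFn_zero ℂ 2 μ).symm

/-- **THE τ-ATOM IS `⊥`** under (NP)τ at the level `U₀`. [cite: MoeglinWaldspurger1995, V.3.13] -/
theorem resGMidAtomτ_eq_bot_of_noMiddlePole
    (hNP : ∀ φ ∈ chiSectionSpacePair (ξ.bcη⁻¹ * ξ.bcψ⁻¹ * μω) ξ.ψ (tauLevel L U₀) ((1 : ↥(tauLevel L U₀) →* ℂ) : ↥(tauLevel L U₀) → ℂ), Continuous φ → IsArchFinite L φ →
      ∀ (Ec : ℂ → (quasiSplit (↥(maximalRealSubfield L)) L (IsCMField.complexConj L) 3).Adelic → ℂ) (Sp : Finset ℂ), (∀ s ∈ Sp, s.im = 0 ∧ 1 < s.re ∧ s.re ≤ 2) →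
        (∀ g, DifferentiableOn ℂ (fun z => Ec z g) ({z : ℂ | 1 < z.re} \ (↑Sp : Set ℂ))) → (∀ z : ℂ, 2 < z.re → Ec z = eisensteinSeriesU (flatSectionU φ z)) →
          ∀ g, Tendsto (fun z => (z - (3 : ℂ) / 2) * Ec z g) (𝓝[≠] ((3 : ℂ) / 2)) (𝓝 0)) :
    resGMidAtomτ L μ ξ μω U₀ = ⊥ := by
  have hspan : Submodule.span ℂ (resGMidAtomGenτ L μ ξ μω U₀) = ⊥ :=
    Submodule.span_eq_bot.2 fun f hf => Set.mem_singleton_iff.1 (resGMidAtomGenτ_subset_zero_of_noMiddlePole L μ ξ μω U₀ hNP hf)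
  have hcl : IsClosed ((⊥ : Submodule ℂ ((quasiSplit (↥(maximalRealSubfield L)) L (IsCMField.complexConj L) 3).L2 μ)) : Set ((quasiSplit (↥(maximalRealSubfield L)) L (IsCMField.complexConj L) 3).L2 μ)) := by
    rw [Submodule.bot_coe]; exact isClosed_singleton
  rw [resGMidAtomτ_def, hspan, hcl.submodule_topologicalClosure_eq]

variable [(quasiSplit (↥(maximalRealSubfield L)) L (IsCMField.complexConj L) 3).IsAutomorphicMeasure μ]

/-- **(NP)τ AT EVERY τ-LEVEL ⟹ `resGMidBlockτ ξ μω = ⊥`** (every τ-atom is `⊥`; ★ `resGMidBlockτ_le ⊥`). [cite: Rogawski1990, §13.9 p. 229 (ii)] [cite: MoeglinWaldspurger1995, IV.1.11, V.3.13] -/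
theorem resGMidBlockτ_eq_bot_of_noMiddlePole
    (hNP : ∀ U₀ : Subgroup ↥(finAdelic (↥(maximalRealSubfield L)) L (IsCMField.complexConj L) 3 ((StdForm.antidiagonal 3).over L)), IsTauLevel L U₀ →
      ∀ φ ∈ chiSectionSpacePair (ξ.bcη⁻¹ * ξ.bcψ⁻¹ * μω) ξ.ψ (tauLevel L U₀) ((1 : ↥(tauLevel L U₀) →* ℂ) : ↥(tauLevel L U₀) → ℂ), Continuous φ → IsArchFinite L φ →
        ∀ (Ec : ℂ → (quasiSplit (↥(maximalRealSubfield L)) L (IsCMField.complexConj L) 3).Adelic → ℂ) (Sp : Finset ℂ), (∀ s ∈ Sp, s.im = 0 ∧ 1 < s.re ∧ s.re ≤ 2) →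
          (∀ g, DifferentiableOn ℂ (fun z => Ec z g) ({z : ℂ | 1 < z.re} \ (↑Sp : Set ℂ))) → (∀ z : ℂ, 2 < z.re → Ec z = eisensteinSeriesU (flatSectionU φ z)) →
            ∀ g, Tendsto (fun z => (z - (3 : ℂ) / 2) * Ec z g) (𝓝[≠] ((3 : ℂ) / 2)) (𝓝 0)) :
    resGMidBlockτ L μ ξ μω = ⊥ :=
  le_bot_iff.1 (resGMidBlockτ_le L μ ξ μω ⊥ fun U₀ hU₀ => by
    rw [resGMidAtomτ_eq_bot_of_noMiddlePole L μ ξ μω U₀ (hNP U₀ hU₀), ClosedSubrep.toSubmodule_bot])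

/-- **(NP)τ + `hW1` ⟹ `resGMidBlock ξ μω = ⊥`**: under the (R)′ letter `hW1 : resGMidBlock ≤ resGMidBlockτ` the full middle block vanishes with the τ-admissible one.
[cite: MoeglinWaldspurger1995, V.3.13] -/
theorem resGMidBlock_eq_bot_of_noMiddlePoleτ (hW1 : resGMidBlock L μ ξ μω ≤ resGMidBlockτ L μ ξ μω)
    (hNP : ∀ U₀ : Subgroup ↥(finAdelic (↥(maximalRealSubfield L)) L (IsCMField.complexConj L) 3 ((StdForm.antidiagonal 3).over L)), IsTauLevel L U₀ →
      ∀ φ ∈ chiSectionSpacePair (ξ.bcη⁻¹ * ξ.bcψ⁻¹ * μω) ξ.ψ (tauLevel L U₀) ((1 : ↥(tauLevel L U₀) →* ℂ) : ↥(tauLevel L U₀) → ℂ), Continuous φ → IsArchFinite L φ →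
        ∀ (Ec : ℂ → (quasiSplit (↥(maximalRealSubfield L)) L (IsCMField.complexConj L) 3).Adelic → ℂ) (Sp : Finset ℂ), (∀ s ∈ Sp, s.im = 0 ∧ 1 < s.re ∧ s.re ≤ 2) →
          (∀ g, DifferentiableOn ℂ (fun z => Ec z g) ({z : ℂ | 1 < z.re} \ (↑Sp : Set ℂ))) → (∀ z : ℂ, 2 < z.re → Ec z = eisensteinSeriesU (flatSectionU φ z)) →
            ∀ g, Tendsto (fun z => (z - (3 : ℂ) / 2) * Ec z g) (𝓝[≠] ((3 : ℂ) / 2)) (𝓝 0)) :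
    resGMidBlock L μ ξ μω = ⊥ :=
  le_bot_iff.1 (hW1.trans (le_of_eq (resGMidBlockτ_eq_bot_of_noMiddlePole L μ ξ μω hNP)))

end NoPole

/-! ## §2 The SCALAR half (★ F4): `φ ≠ 1`, `L(½, φ) = 0 ⟹ G(3∕2) = 0` -/

section Scalar

variable {L : Type} [Field L] [NumberField L]

/-- **`G(3∕2) = 0` WHEN `L(½, φ) = 0`** for ★ F4's `G` (`(z−2)(2z−3)·c = G`): if `η ≠ 1` then `G(3∕2) = 0` outright (F4); if `η = 1` and `φ ≠ 1` then `G(3∕2) ≠ 0 ↔ LHalfNeZero φ` (F4), so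
`¬ LHalfNeZero φ` forces `G(3∕2) = 0`. [cite: Rogawski1990, §13.9 p. 229 (ii)] [cite: MoeglinWaldspurger1995, IV.1.11] -/
theorem chiScalarG_three_halves_eq_zero_of_not_lHalfNeZero {φ : HeckeCharacter L} {η : HeckeCharacter ↥(maximalRealSubfield L)} {G : ℂ → ℂ}
    (hG0 : η ≠ 1 → G (3 / 2) = 0) (hG32 : η = 1 → φ ≠ 1 → (G (3 / 2) ≠ 0 ↔ LHalfNeZero φ)) (hφ1 : φ ≠ 1) (hL : ¬ LHalfNeZero φ) : G (3 / 2) = 0 := by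
  by_cases hη : η = 1
  · by_contra h
    exact hL ((hG32 hη hφ1).1 h)
  · exact hG0 hη

end Scalar

/-! ## §3 The COORDINATES (★ F5): zero residue at `3∕2` of every coordinate factorised through `c`, of finite sums, and of the CT coefficient through its expansion -/

section Coord

/-- **A COORDINATE FACTORISED THROUGH THE SCALAR HAS ZERO RESIDUE AT `3∕2` WHEN `G(3∕2) = 0`**: `Q = a·M` on the tube `{2 < Re}` with `a` holomorphic on `{1 < Re}`, `Qc = Q` on the tube, `Qc`
analytic off a co-discrete `P`, `(z−2)(2z−3)·M = G` on the tube with `G` holomorphic on `{1<Re}` and `G(3∕2) = 0` ⟹ `(z − 3∕2)·Qc z → 0` on `𝓝[≠] (3∕2)` (★ F5 `tendsto_sub_three_halves_mul_qc`: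
the limit is `−(a(3∕2)·G(3∕2)) = 0`). [cite: MoeglinWaldspurger1995, IV.1.11] [cite: Rogawski1990, §13.9 p. 229 (ii)] -/
theorem tendsto_sub_three_halves_mul_coord_of_factorisation (Q Qc : ℂ → ℂ) {P : Set ℂ} (hqcq : ∀ z : ℂ, 2 < z.re → Qc z = Q z) (hPcd : ∀ z₀ : ℂ, ∀ᶠ s in 𝓝[≠] z₀, s ∉ P)
    (hqa : ∀ z : ℂ, z ∉ P → AnalyticAt ℂ Qc z) (a : ℂ → ℂ) (ha : DifferentiableOn ℂ a {z : ℂ | 1 < z.re}) (M : ℂ → ℂ) (hfac : ∀ z : ℂ, 2 < z.re → Q z = a z * M z)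
    (G : ℂ → ℂ) (hG : DifferentiableOn ℂ G {z : ℂ | 1 < z.re}) (hGeq : ∀ z : ℂ, 2 < z.re → (z - 2) * (2 * z - 3) * M z = G z) (hG32 : G (3 / 2) = 0) :
    Tendsto (fun z : ℂ => (z - 3 / 2) * Qc z) (𝓝[≠] (3 / 2)) (𝓝 0) := by
  have h := tendsto_sub_three_halves_mul_qc Q Qc hqcq hPcd hqa a ha M hfac G hG hGeq
  rwa [hG32, mul_zero, neg_zero] at h

/-- **Finite sums**: if every `(z − 3∕2)·Qc_j z → 0` then `(z − 3∕2)·Σ_j Qc_j z·c_j → 0`. [folklore] -/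
theorem tendsto_sub_three_halves_mul_sum {ι : Type*} [Fintype ι] (Qc : ι → ℂ → ℂ) (c : ι → ℂ)
    (h : ∀ j, Tendsto (fun z : ℂ => (z - 3 / 2) * Qc j z) (𝓝[≠] (3 / 2)) (𝓝 0)) :
    Tendsto (fun z : ℂ => (z - 3 / 2) * ∑ j, Qc j z * c j) (𝓝[≠] (3 / 2)) (𝓝 0) := by
  have e : (fun z : ℂ => (z - 3 / 2) * ∑ j, Qc j z * c j) = fun z => ∑ j, (z - 3 / 2) * Qc j z * c j := by
    funext z
    rw [Finset.mul_sum]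
    exact Finset.sum_congr rfl fun j _ => by ring
  rw [e]
  have hs := tendsto_finsetSum (Finset.univ : Finset ι) fun j _ => (h j).mul_const (c j)
  simpa only [zero_mul, Finset.sum_const_zero] using hs

/-- **The CT coefficient through its eventual coordinate expansion**: if `ψ z =ᶠ Σ_j Qc_j z·c_j` on `𝓝[≠] (3∕2)` and every coordinate has zero residue there, then `(z − 3∕2)·ψ z → 0`.
[cite: MoeglinWaldspurger1995, IV.1.11] -/
theorem tendsto_sub_three_halves_mul_of_eventuallyEq_sum {ι : Type*} [Fintype ι] (ψ : ℂ → ℂ) (Qc : ι → ℂ → ℂ) (c : ι → ℂ)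
    (hexp : ∀ᶠ z in 𝓝[≠] ((3 : ℂ) / 2), ψ z = ∑ j, Qc j z * c j)
    (h : ∀ j, Tendsto (fun z : ℂ => (z - 3 / 2) * Qc j z) (𝓝[≠] (3 / 2)) (𝓝 0)) :
    Tendsto (fun z : ℂ => (z - 3 / 2) * ψ z) (𝓝[≠] (3 / 2)) (𝓝 0) :=
  (tendsto_sub_three_halves_mul_sum Qc c h).congr' (by
    filter_upwards [hexp] with z hz
    rw [hz])

end Coord

/-! ## §5 HEADS: (V♭) OF RECORD on `resGMidBlockτ`, and on `resGMidBlock` under `hW1` -/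

section Record

variable (L : Type) [Field L] [NumberField L] [IsCMField L]
  [MeasurableSpace (quasiSplit (↥(maximalRealSubfield L)) L (IsCMField.complexConj L) 3).Adelic]
  (μ : Measure (quasiSplit (↥(maximalRealSubfield L)) L (IsCMField.complexConj L) 3).automorphicQuotient) [(quasiSplit (↥(maximalRealSubfield L)) L (IsCMField.complexConj L) 3).IsAutomorphicMeasure μ]
  (ξ : OneDimAutRepH L) (μω : HeckeCharacter L)
  (ν : Measure ↥(adelicUnipotent (↥(maximalRealSubfield L)) L (IsCMField.complexConj L) 3)) (𝓕 : Set ↥(adelicUnipotent (↥(maximalRealSubfield L)) L (IsCMField.complexConj L) 3))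

/-- **(V♭)τ OF RECORD — `¬ LHalfNeZero (ξ.bcη⁻¹·μω) → resGMidBlockτ ξ μω = ⊥` MODULO THE TWO NAMED ESTATE LETTERS.**  Frame: ★ F4's data for `φ := ξ.bcη⁻¹·μω` (unitary, trivial on the positive
reals, unramified off the finite `S`) and the finite `T` (the trivial character of `L⁺` is unramified off `T`), and `hφ1 : φ ≠ 1`.  Letters: **`hfacτ`** — for every τ-level `U₀`, every τ-admissible
generator datum `(φ, Ec, Sp)` (★ T3's clauses) there are finitely many coordinates `Q_j, Qc_j` (equal on the tube; `Qc_j` analytic off a co-discrete `P`), amplitudes `a_j` holomorphic on `{1 < Re}`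
with the FACTORISATION `Q_j z = a_j z · c(z)` on `{2 < Re}` through the block's scalar `c = L^S(z−1,φ)ζ^T(2z−2)∕(L^S(z,φ)ζ^T(2z−1))`, and values `b_j g`, such that the second constant-term
coefficient of `Ec` expands as `Σ_j Qc_j(z)·b_j(g)` on a punctured neighbourhood of `3∕2`, for every `g`; **`hVEC`** — for every such datum, if that coefficient has zero residue at `3∕2` for every `g`
then `(z − 3∕2)·Ec z g → 0` for every `g` (MW IV.1.11, vector half).  THEN `¬ LHalfNeZero φ → resGMidBlockτ ξ μω = ⊥` (★ F4: `G(3∕2) = 0` §2; ★ F5 per coordinate §3; `hVEC`; §1).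
[cite: Rogawski1990, §13.9 p. 229 (ii)] [cite: MoeglinWaldspurger1995, IV.1.11, V.3.13] [cite: Langlands1976, §7] -/
theorem resGMidBlockτ_eq_bot_of_not_lHalfNeZero_of_record
    -- ★ F4's frame for `φ := ξ.bcη⁻¹·μω`, `η := 1`
    (hφu : (ξ.bcη⁻¹ * μω).IsUnitary) (hφA : ∀ t : ℝ≥0ˣ, (ξ.bcη⁻¹ * μω) (posRealIdele L t) = 1)
    {S : Set (HeightOneSpectrum (𝓞 L))} (hS : S.Finite) (hurφ : ∀ w ∉ S, (ξ.bcη⁻¹ * μω).IsUnramifiedAt w)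
    {T : Set (HeightOneSpectrum (𝓞 ↥(maximalRealSubfield L)))} (hT : T.Finite) (hurη : ∀ v ∉ T, (1 : HeckeCharacter ↥(maximalRealSubfield L)).IsUnramifiedAt v)
    (hφ1 : ξ.bcη⁻¹ * μω ≠ 1)
    -- LETTER `hfacτ`: the coordinate factorisation of EVERY τ-admissible generator, and the eventual coordinate expansion of its second CT coefficient
    (hfacτ : ∀ U₀ : Subgroup ↥(finAdelic (↥(maximalRealSubfield L)) L (IsCMField.complexConj L) 3 ((StdForm.antidiagonal 3).over L)), IsTauLevel L U₀ →
      ∀ φ ∈ chiSectionSpacePair (ξ.bcη⁻¹ * ξ.bcψ⁻¹ * μω) ξ.ψ (tauLevel L U₀) ((1 : ↥(tauLevel L U₀) →* ℂ) : ↥(tauLevel L U₀) → ℂ), Continuous φ → IsArchFinite L φ →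
        ∀ (Ec : ℂ → (quasiSplit (↥(maximalRealSubfield L)) L (IsCMField.complexConj L) 3).Adelic → ℂ) (Sp : Finset ℂ), (∀ s ∈ Sp, s.im = 0 ∧ 1 < s.re ∧ s.re ≤ 2) →
          (∀ g, DifferentiableOn ℂ (fun z => Ec z g) ({z : ℂ | 1 < z.re} \ (↑Sp : Set ℂ))) → (∀ z : ℂ, 2 < z.re → Ec z = eisensteinSeriesU (flatSectionU φ z)) →
            ∃ (n : ℕ) (Q Qc a : Fin n → ℂ → ℂ) (b : Fin n → (quasiSplit (↥(maximalRealSubfield L)) L (IsCMField.complexConj L) 3).Adelic → ℂ) (P : Set ℂ),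
              (∀ j (z : ℂ), 2 < z.re → Qc j z = Q j z) ∧ (∀ z₀ : ℂ, ∀ᶠ s in 𝓝[≠] z₀, s ∉ P) ∧ (∀ j (z : ℂ), z ∉ P → AnalyticAt ℂ (Qc j) z) ∧
              (∀ j, DifferentiableOn ℂ (a j) {z : ℂ | 1 < z.re}) ∧
              (∀ j (z : ℂ), 2 < z.re → Q j z = a j z *
                ((partialStandardL S (fun w => {(ξ.bcη⁻¹ * μω).valueAtUniformizer w}) (z - 1) * partialStandardL T (fun v => {(1 : HeckeCharacter ↥(maximalRealSubfield L)).valueAtUniformizer v}) (2 * z - 2)) /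
                  (partialStandardL S (fun w => {(ξ.bcη⁻¹ * μω).valueAtUniformizer w}) z * partialStandardL T (fun v => {(1 : HeckeCharacter ↥(maximalRealSubfield L)).valueAtUniformizer v}) (2 * z - 1)))) ∧
              ∀ g, ∀ᶠ z in 𝓝[≠] ((3 : ℂ) / 2),
                (borelConstantTerm ν 𝓕 (Ec z) g - φ g * (((borelHeight g : ℝ≥0) : ℝ) : ℂ) ^ z) / (((borelHeight g : ℝ≥0) : ℝ) : ℂ) ^ (2 - z) = ∑ j, Qc j z * b j g)
    -- LETTER `hVEC`: MW IV.1.11, vector half — zero CT-residue at `3∕2` ⟹ zero residue at `3∕2`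
    (hVEC : ∀ U₀ : Subgroup ↥(finAdelic (↥(maximalRealSubfield L)) L (IsCMField.complexConj L) 3 ((StdForm.antidiagonal 3).over L)), IsTauLevel L U₀ →
      ∀ φ ∈ chiSectionSpacePair (ξ.bcη⁻¹ * ξ.bcψ⁻¹ * μω) ξ.ψ (tauLevel L U₀) ((1 : ↥(tauLevel L U₀) →* ℂ) : ↥(tauLevel L U₀) → ℂ), Continuous φ → IsArchFinite L φ →
        ∀ (Ec : ℂ → (quasiSplit (↥(maximalRealSubfield L)) L (IsCMField.complexConj L) 3).Adelic → ℂ) (Sp : Finset ℂ), (∀ s ∈ Sp, s.im = 0 ∧ 1 < s.re ∧ s.re ≤ 2) →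
          (∀ g, DifferentiableOn ℂ (fun z => Ec z g) ({z : ℂ | 1 < z.re} \ (↑Sp : Set ℂ))) → (∀ z : ℂ, 2 < z.re → Ec z = eisensteinSeriesU (flatSectionU φ z)) →
            (∀ g, Tendsto (fun z : ℂ => (z - 3 / 2) * ((borelConstantTerm ν 𝓕 (Ec z) g - φ g * (((borelHeight g : ℝ≥0) : ℝ) : ℂ) ^ z) / (((borelHeight g : ℝ≥0) : ℝ) : ℂ) ^ (2 - z)))
              (𝓝[≠] (3 / 2)) (𝓝 0)) →
              ∀ g, Tendsto (fun z => (z - (3 : ℂ) / 2) * Ec z g) (𝓝[≠] ((3 : ℂ) / 2)) (𝓝 0)) :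
    ¬ LHalfNeZero (ξ.bcη⁻¹ * μω) → resGMidBlockτ L μ ξ μω = ⊥ := by
  intro hL
  -- ★ F4 for `(φ, η) := (ξ.bcη⁻¹·μω, 1)`: the scalar weight identity and `G(3∕2) = 0`
  obtain ⟨G, hG, hGeq, -, hG0, hG32⟩ := exists_differentiableOn_mul_chiScalar_cm_three L hφu hφA hS hurφ HeckeCharacter.isUnitary_one
    (fun t => by rw [HeckeCharacter.one_apply]) hT hurη
  have hG32' : G (3 / 2) = 0 := chiScalarG_three_halves_eq_zero_of_not_lHalfNeZero hG0 hG32 hφ1 hL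
  refine resGMidBlockτ_eq_bot_of_noMiddlePole L μ ξ μω fun U₀ hU₀ φ hφ hφc hφa Ec Sp hSp hhol hEis => ?_
  obtain ⟨n, Q, Qc, a, b, P, hqcq, hPcd, hqa, ha, hfac, hexp⟩ := hfacτ U₀ hU₀ φ hφ hφc hφa Ec Sp hSp hhol hEis
  -- every coordinate has zero residue at `3∕2` (★ F5), hence so has the CT coefficient at every `g`
  have hcoord : ∀ j, Tendsto (fun z : ℂ => (z - 3 / 2) * Qc j z) (𝓝[≠] (3 / 2)) (𝓝 0) := fun j =>
    tendsto_sub_three_halves_mul_coord_of_factorisation (Q j) (Qc j) (hqcq j) hPcd (hqa j) (a j) (ha j) _ (hfac j) G hG hGeq hG32'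
  have hψ : ∀ g, Tendsto (fun z : ℂ => (z - 3 / 2) * ((borelConstantTerm ν 𝓕 (Ec z) g - φ g * (((borelHeight g : ℝ≥0) : ℝ) : ℂ) ^ z) / (((borelHeight g : ℝ≥0) : ℝ) : ℂ) ^ (2 - z)))
      (𝓝[≠] (3 / 2)) (𝓝 0) := fun g =>
    tendsto_sub_three_halves_mul_of_eventuallyEq_sum _ Qc (fun j => b j g) (hexp g) hcoord
  exact hVEC U₀ hU₀ φ hφ hφc hφa Ec Sp hSp hhol hEis hψ

/-- **(V♭) OF RECORD — THE SOCKET BYTES `¬ LHalfNeZero (ξ.bcη⁻¹ * μω) → resGMidBlock L μ ξ μω = ⊥`** modulo `hW1 : resGMidBlock ≤ resGMidBlockτ` ((R)′'s letter; `le_rfl` under B ED. 8), ★ F4's frame with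
`hφ1`, and the two named estate letters `hfacτ`, `hVEC` of `resGMidBlockτ_eq_bot_of_not_lHalfNeZero_of_record`. [cite: Rogawski1990, §13.9 p. 229 (ii)] [cite: MoeglinWaldspurger1995, IV.1.11, V.3.13] [cite: Langlands1976, §7] -/
theorem resGMidBlock_eq_bot_of_not_lHalfNeZero_of_record (hW1 : resGMidBlock L μ ξ μω ≤ resGMidBlockτ L μ ξ μω)
    (hφu : (ξ.bcη⁻¹ * μω).IsUnitary) (hφA : ∀ t : ℝ≥0ˣ, (ξ.bcη⁻¹ * μω) (posRealIdele L t) = 1)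
    {S : Set (HeightOneSpectrum (𝓞 L))} (hS : S.Finite) (hurφ : ∀ w ∉ S, (ξ.bcη⁻¹ * μω).IsUnramifiedAt w)
    {T : Set (HeightOneSpectrum (𝓞 ↥(maximalRealSubfield L)))} (hT : T.Finite) (hurη : ∀ v ∉ T, (1 : HeckeCharacter ↥(maximalRealSubfield L)).IsUnramifiedAt v)
    (hφ1 : ξ.bcη⁻¹ * μω ≠ 1)
    (hfacτ : ∀ U₀ : Subgroup ↥(finAdelic (↥(maximalRealSubfield L)) L (IsCMField.complexConj L) 3 ((StdForm.antidiagonal 3).over L)), IsTauLevel L U₀ →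
      ∀ φ ∈ chiSectionSpacePair (ξ.bcη⁻¹ * ξ.bcψ⁻¹ * μω) ξ.ψ (tauLevel L U₀) ((1 : ↥(tauLevel L U₀) →* ℂ) : ↥(tauLevel L U₀) → ℂ), Continuous φ → IsArchFinite L φ →
        ∀ (Ec : ℂ → (quasiSplit (↥(maximalRealSubfield L)) L (IsCMField.complexConj L) 3).Adelic → ℂ) (Sp : Finset ℂ), (∀ s ∈ Sp, s.im = 0 ∧ 1 < s.re ∧ s.re ≤ 2) →
          (∀ g, DifferentiableOn ℂ (fun z => Ec z g) ({z : ℂ | 1 < z.re} \ (↑Sp : Set ℂ))) → (∀ z : ℂ, 2 < z.re → Ec z = eisensteinSeriesU (flatSectionU φ z)) →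
            ∃ (n : ℕ) (Q Qc a : Fin n → ℂ → ℂ) (b : Fin n → (quasiSplit (↥(maximalRealSubfield L)) L (IsCMField.complexConj L) 3).Adelic → ℂ) (P : Set ℂ),
              (∀ j (z : ℂ), 2 < z.re → Qc j z = Q j z) ∧ (∀ z₀ : ℂ, ∀ᶠ s in 𝓝[≠] z₀, s ∉ P) ∧ (∀ j (z : ℂ), z ∉ P → AnalyticAt ℂ (Qc j) z) ∧
              (∀ j, DifferentiableOn ℂ (a j) {z : ℂ | 1 < z.re}) ∧
              (∀ j (z : ℂ), 2 < z.re → Q j z = a j z *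
                ((partialStandardL S (fun w => {(ξ.bcη⁻¹ * μω).valueAtUniformizer w}) (z - 1) * partialStandardL T (fun v => {(1 : HeckeCharacter ↥(maximalRealSubfield L)).valueAtUniformizer v}) (2 * z - 2)) /
                  (partialStandardL S (fun w => {(ξ.bcη⁻¹ * μω).valueAtUniformizer w}) z * partialStandardL T (fun v => {(1 : HeckeCharacter ↥(maximalRealSubfield L)).valueAtUniformizer v}) (2 * z - 1)))) ∧
              ∀ g, ∀ᶠ z in 𝓝[≠] ((3 : ℂ) / 2),
                (borelConstantTerm ν 𝓕 (Ec z) g - φ g * (((borelHeight g : ℝ≥0) : ℝ) : ℂ) ^ z) / (((borelHeight g : ℝ≥0) : ℝ) : ℂ) ^ (2 - z) = ∑ j, Qc j z * b j g)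
    (hVEC : ∀ U₀ : Subgroup ↥(finAdelic (↥(maximalRealSubfield L)) L (IsCMField.complexConj L) 3 ((StdForm.antidiagonal 3).over L)), IsTauLevel L U₀ →
      ∀ φ ∈ chiSectionSpacePair (ξ.bcη⁻¹ * ξ.bcψ⁻¹ * μω) ξ.ψ (tauLevel L U₀) ((1 : ↥(tauLevel L U₀) →* ℂ) : ↥(tauLevel L U₀) → ℂ), Continuous φ → IsArchFinite L φ →
        ∀ (Ec : ℂ → (quasiSplit (↥(maximalRealSubfield L)) L (IsCMField.complexConj L) 3).Adelic → ℂ) (Sp : Finset ℂ), (∀ s ∈ Sp, s.im = 0 ∧ 1 < s.re ∧ s.re ≤ 2) →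
          (∀ g, DifferentiableOn ℂ (fun z => Ec z g) ({z : ℂ | 1 < z.re} \ (↑Sp : Set ℂ))) → (∀ z : ℂ, 2 < z.re → Ec z = eisensteinSeriesU (flatSectionU φ z)) →
            (∀ g, Tendsto (fun z : ℂ => (z - 3 / 2) * ((borelConstantTerm ν 𝓕 (Ec z) g - φ g * (((borelHeight g : ℝ≥0) : ℝ) : ℂ) ^ z) / (((borelHeight g : ℝ≥0) : ℝ) : ℂ) ^ (2 - z)))
              (𝓝[≠] (3 / 2)) (𝓝 0)) →
              ∀ g, Tendsto (fun z => (z - (3 : ℂ) / 2) * Ec z g) (𝓝[≠] ((3 : ℂ) / 2)) (𝓝 0)) :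
    ¬ LHalfNeZero (ξ.bcη⁻¹ * μω) → resGMidBlock L μ ξ μω = ⊥ := fun hL =>
  le_bot_iff.1 (hW1.trans (le_of_eq (resGMidBlockτ_eq_bot_of_not_lHalfNeZero_of_record L μ ξ μω ν 𝓕 hφu hφA hS hurφ hT hurη hφ1 hfacτ hVEC hL)))

/-- **CONTRAPOSITIVE OF RECORD — a non-zero τ-admissible middle block forces `L(½, φ_ξ) ≠ 0`** (modulo the same letters), the shape ★ F2_qs's index passage consumes for #2♯.
[cite: Rogawski1990, §13.9 p. 229 (ii)] [cite: Langlands1976, §7] -/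
theorem lHalfNeZero_of_resGMidBlockτ_ne_bot_of_record
    (hφu : (ξ.bcη⁻¹ * μω).IsUnitary) (hφA : ∀ t : ℝ≥0ˣ, (ξ.bcη⁻¹ * μω) (posRealIdele L t) = 1)
    {S : Set (HeightOneSpectrum (𝓞 L))} (hS : S.Finite) (hurφ : ∀ w ∉ S, (ξ.bcη⁻¹ * μω).IsUnramifiedAt w)
    {T : Set (HeightOneSpectrum (𝓞 ↥(maximalRealSubfield L)))} (hT : T.Finite) (hurη : ∀ v ∉ T, (1 : HeckeCharacter ↥(maximalRealSubfield L)).IsUnramifiedAt v)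
    (hφ1 : ξ.bcη⁻¹ * μω ≠ 1)
    (hfacτ : ∀ U₀ : Subgroup ↥(finAdelic (↥(maximalRealSubfield L)) L (IsCMField.complexConj L) 3 ((StdForm.antidiagonal 3).over L)), IsTauLevel L U₀ →
      ∀ φ ∈ chiSectionSpacePair (ξ.bcη⁻¹ * ξ.bcψ⁻¹ * μω) ξ.ψ (tauLevel L U₀) ((1 : ↥(tauLevel L U₀) →* ℂ) : ↥(tauLevel L U₀) → ℂ), Continuous φ → IsArchFinite L φ →
        ∀ (Ec : ℂ → (quasiSplit (↥(maximalRealSubfield L)) L (IsCMField.complexConj L) 3).Adelic → ℂ) (Sp : Finset ℂ), (∀ s ∈ Sp, s.im = 0 ∧ 1 < s.re ∧ s.re ≤ 2) →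
          (∀ g, DifferentiableOn ℂ (fun z => Ec z g) ({z : ℂ | 1 < z.re} \ (↑Sp : Set ℂ))) → (∀ z : ℂ, 2 < z.re → Ec z = eisensteinSeriesU (flatSectionU φ z)) →
            ∃ (n : ℕ) (Q Qc a : Fin n → ℂ → ℂ) (b : Fin n → (quasiSplit (↥(maximalRealSubfield L)) L (IsCMField.complexConj L) 3).Adelic → ℂ) (P : Set ℂ),
              (∀ j (z : ℂ), 2 < z.re → Qc j z = Q j z) ∧ (∀ z₀ : ℂ, ∀ᶠ s in 𝓝[≠] z₀, s ∉ P) ∧ (∀ j (z : ℂ), z ∉ P → AnalyticAt ℂ (Qc j) z) ∧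
              (∀ j, DifferentiableOn ℂ (a j) {z : ℂ | 1 < z.re}) ∧
              (∀ j (z : ℂ), 2 < z.re → Q j z = a j z *
                ((partialStandardL S (fun w => {(ξ.bcη⁻¹ * μω).valueAtUniformizer w}) (z - 1) * partialStandardL T (fun v => {(1 : HeckeCharacter ↥(maximalRealSubfield L)).valueAtUniformizer v}) (2 * z - 2)) /
                  (partialStandardL S (fun w => {(ξ.bcη⁻¹ * μω).valueAtUniformizer w}) z * partialStandardL T (fun v => {(1 : HeckeCharacter ↥(maximalRealSubfield L)).valueAtUniformizer v}) (2 * z - 1)))) ∧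
              ∀ g, ∀ᶠ z in 𝓝[≠] ((3 : ℂ) / 2),
                (borelConstantTerm ν 𝓕 (Ec z) g - φ g * (((borelHeight g : ℝ≥0) : ℝ) : ℂ) ^ z) / (((borelHeight g : ℝ≥0) : ℝ) : ℂ) ^ (2 - z) = ∑ j, Qc j z * b j g)
    (hVEC : ∀ U₀ : Subgroup ↥(finAdelic (↥(maximalRealSubfield L)) L (IsCMField.complexConj L) 3 ((StdForm.antidiagonal 3).over L)), IsTauLevel L U₀ →
      ∀ φ ∈ chiSectionSpacePair (ξ.bcη⁻¹ * ξ.bcψ⁻¹ * μω) ξ.ψ (tauLevel L U₀) ((1 : ↥(tauLevel L U₀) →* ℂ) : ↥(tauLevel L U₀) → ℂ), Continuous φ → IsArchFinite L φ →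
        ∀ (Ec : ℂ → (quasiSplit (↥(maximalRealSubfield L)) L (IsCMField.complexConj L) 3).Adelic → ℂ) (Sp : Finset ℂ), (∀ s ∈ Sp, s.im = 0 ∧ 1 < s.re ∧ s.re ≤ 2) →
          (∀ g, DifferentiableOn ℂ (fun z => Ec z g) ({z : ℂ | 1 < z.re} \ (↑Sp : Set ℂ))) → (∀ z : ℂ, 2 < z.re → Ec z = eisensteinSeriesU (flatSectionU φ z)) →
            (∀ g, Tendsto (fun z : ℂ => (z - 3 / 2) * ((borelConstantTerm ν 𝓕 (Ec z) g - φ g * (((borelHeight g : ℝ≥0) : ℝ) : ℂ) ^ z) / (((borelHeight g : ℝ≥0) : ℝ) : ℂ) ^ (2 - z)))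
              (𝓝[≠] (3 / 2)) (𝓝 0)) →
              ∀ g, Tendsto (fun z => (z - (3 : ℂ) / 2) * Ec z g) (𝓝[≠] ((3 : ℂ) / 2)) (𝓝 0))
    (hne : (resGMidBlockτ L μ ξ μω).toSubmodule ≠ ⊥) : LHalfNeZero (ξ.bcη⁻¹ * μω) := by
  by_contra hL
  exact hne (by rw [resGMidBlockτ_eq_bot_of_not_lHalfNeZero_of_record L μ ξ μω ν 𝓕 hφu hφA hS hurφ hT hurη hφ1 hfacτ hVEC hL, ClosedSubrep.toSubmodule_bot])

end Record

end Summit.HodgeConjecture.HodgeConjecture.R90.S8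

end
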